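import Summits.RiemannHypothesis.RiemannHypothesis.Theorems.LiPrimeEchoDefs
import Literature.NumberTheory.LFunctions.LiCriterionDirichlet
import Literature.NumberTheory.LFunctions.DirichletXiConjugation
import Literature.NumberTheory.LFunctions.ExplicitFormulaPsiCharHeights
import Literature.NumberTheory.LFunctions.ExplicitFormulaPsiCharLogDeriv
import HarnessLib

/-!
# RiemannHypothesis / LI column — vocabulary PART E and the rung leaf «Li PRIME-ECHO LAW FOR DIRICHLET CHARACTERS»
# (RH-FREE and GRH-FREE, all `n`, every primitive `χ`)

Cell `pub/rh-li` (D-0040/D-0059/D-0061), round 4 (theory g7; dossier `theory/route/p5/README-P5.md`).  Statement-only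
module (`def`s + `@[conjecture]` targets + PROVED glue; no `sorry`, no axioms), the successor of PART D
(`Theorems/LiPrimeEchoDefs.lean`, leaf `LiZeroWindowEcho` = route `Theses/LiPrimeEcho.lean`).  It types the FAMILY
VERSION of the column's data-row object: the prime echo heard in the zeros of a Dirichlet `L`-function `L(s, χ)` is the
SAME chirp, re-weighted by the character value — «the zeros of `L(s, χ)` at height `≍ √n` chirp the prime 2 with
amplitude `Re χ(2) · A₂`».

THE LAW (leaf `LiZeroWindowEchoDirichlet`).  `χ` a primitive character mod `q > 1`, `a = charParity χ ∈ {0, 1}`,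
`z_ρ = 1 − 1/ρ`, `θ(t) = 2 arctan(1/2t)` (`liZeroAngle`, PART A), and the character's Riemann–von Mangoldt density
`g_χ(t) = ½ Re ψ((½ + a + it)/2) + ½ log(q/π)` (`charGammaDensity`; `N(T, χ) = #{ρ : |Im ρ| ≤ T} ∼ (2/π)∫₀ᵀ g_χ =
(T/π) log(qT/2πe) + O(log qT)`).  For every fixed `c ≥ 5/4` and all `n ≥ 2`,
`Σ_{√n < |Im ρ| ≤ c√n} Re m_ρ z_ρ^n − (2/π) ∫_{√n}^{c√n} cos(nθ(t)) g_χ(t) dt = −Re χ(2) · A₂ n^{1/4} cos(2√(n log 2) + π/4)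
+ O_{χ,c}(log² n)` — the sum over ALL zeros of `L(s, χ)` of the window (both signs of `Im ρ`, any real part, with
multiplicity `m_ρ = DirichletDisc.zeroOrder χ ρ`; zero set `lfunctionZeroBox χ`, the boxes of the tree's GRH-Li criterion
`LiDirichlet.riemannHypothesis_iff_liCoeffCharRe_nonneg`).  PRE-REGISTERED CLASSES (the data test ET3 of the column,
STATUS 2026-08-26T01:20Z, extended here to complex characters): `χ(2) = −1` (mod 3; the real character mod 5) ⇒
SIGN-FLIPPED echo; `q` even (mod 4, both mod 8) ⇒ `χ(2) = 0` ⇒ SILENT window (PROVED from the leaf below,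
`liZeroWindowSilentDirichlet_of`); mod 7 real (`2 ≡ 3²`) ⇒ `χ(2) = +1`, SAME echo as `ζ`; the order-4 characters mod 5
(`χ(2) = ±i`) ⇒ `Re χ(2) = 0` ⇒ QUADRATURE-SILENT in this (cosine, both-signs) statistic although `χ(2) ≠ 0` — their
chirp sits entirely in the odd statistic `Σ sgn(Im ρ) Im z_ρ^n` (not typed here); general complex `χ`: amplitude
`Re χ(2) · 0.36400`, phase `π/4` unchanged.

WHY `Re χ(2)` AND NO CONVENTION.  The zeros of `L(s, χ)` with `Im ρ < 0` are the conjugates of the zeros of `L(s, χ̄)`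
with `Im ρ > 0` (`L(s̄, χ̄) = conj L(s, χ)`), so the both-signs window statistic of `χ` is `U_n(χ) + U_n(χ̄)` with
`U_n(χ) = Re Σ_{upper zeros of L(χ)} m_ρ z_ρ^n` (`charUpperTraceWindow`).  Bombieri's rectangle `[−1/2, 3/2] × [T₁, T₂]`
for `F_n · ξ'/ξ(·, χ)` (`ξ(s, χ) = dirichletXi χ s = (q/π)^{(s+a)/2} Γ((s+a)/2) L(s, χ)`, ENTIRE, zeros = the non-trivial
zeros; NO polar term since `q > 1`) gives, exactly as in PART D — left edge folded onto `Re w = 3/2` by `ξ'/ξ(1 − w̄, χ) =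
−conj ξ'/ξ(w, χ)` (`logDeriv_completed_one_sub` + `conj_dirichletXi`: the `χ̄` of the functional equation and the `χ̄`
of the conjugation CANCEL) — `2 U_n(χ; T₁, T₂) = charRightEdge χ + charHorizTerm χ T₁ − charHorizTerm χ T₂` with
`ξ'/ξ(w, χ) = ½ log(q/π) + ½ ψ((w+a)/2) − Σ_m Λ(m) χ(m) m^{−w}` on `Re w = 3/2`: the gamma piece shifted to `Re w = ½` IS
the smooth mean, and in the prime piece the single resonant term `Λ(2) χ(2) 2^{−w} F_n(1 − w)` (phase `−(n/y + y log 2)`,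
stationary at `y₀ = √(n/log 2) = 1.2011 √n ∈ (√n, c√n]`) evaluates to `Re[χ(2) · A₂ n^{1/4} e^{−i(2√(n log 2) + π/4)}] =
liPrimeEchoTwist (χ 2) 2 n`; adding the same for `χ̄` gives `2 Re χ(2) · E₂(n)` for `2·(both-signs statistic)`
(`liPrimeEchoTwist_add_conj`, PROVED).  The mechanism is the route-LiPrimeEcho mechanism verbatim with the tree's
character inputs: good heights `ExplicitPsiChar.exists_goodHeight` (MV Lemma 12.7), strip bound
`ExplicitPsiChar.exists_norm_logDeriv_LFunction_le_strip`, zero counting in unit windows `ExplicitPsiChar.exists_sum_window_le`,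
functional equation / conjugation `ExplicitPsiChar.logDeriv_completed_one_sub`, `DirichletTheta.conj_dirichletXi`.

RH-FREE / GRH-FREE FOR ALL `n` (rule 4 label): every zero of the window is summed WHATEVER ITS REAL PART (`|z_ρ^n| ≤
e^{1/2}` for `|Im ρ| ≥ √n` unconditionally); the truth value of the leaf does not depend on RH or on GRH for `χ`, and
nothing here bears on the truth of RH.  It is PROOF-OF-DATA for row L-D's family test ET3 and NOT height-buying.  Sources
and ancestry: Landau 1911 / Gonek 1993 (`Σ_{0<γ≤T} x^ρ = −(T/2π)Λ(x) + …`) and its character form (Ford–Zaharescu 2005,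
Ford–Soundararajan–Zaharescu 2009: `Σ x^ρ` over zeros of `L(s, χ)` carries `Λ(x)χ(x)`); Li's criterion for Dirichlet
`L` (Li 2004 JNT 105, `LiCriterionDirichlet.lean`); numerics of `λ_χ(n)`: Omar–Mazhouda 2007/2010 — none isolates a
character-signed `n^{1/4}` prime chirp of a zero window (novelty record in the route header).

FENCES.  (i) GRH-EQUIVALENT statements (`λ_χ(n) ≥ 0` for all `n`) are NOT targets here.  (ii) The leaf concerns a
WINDOW of zeros at height `≍ √n` and is consistent with any zero configuration obeying the known density theorems.
(iii) The companions typed below (`LiZeroWindowSilentDirichlet`, `LiZeroWindowEchoesDirichlet`) are targets of the same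
family, NOT route items; the PROVED glue records how they hang together.
-/

noncomputable section

-- D-0017: `Summit.<S>.<S>.…` is the designed namespace of a single-problem summit.
set_option linter.dupNamespace false

open MeasureTheory intervalIntegral
open scoped ArithmeticFunction.vonMangoldt ComplexConjugate

namespace Summit.RiemannHypothesis.RiemannHypothesis.Theorems.LiTheory

open Literature.NumberTheory.LFunctions Literature.NumberTheory.LFunctions.DirichletTheta

variable {q : ℕ} [NeZero q]

/-! ## PART E — zero-side and smooth-side vocabulary for `L(s, χ)` -/

/-- The Li ZERO TRACE of `L(s, χ)` up to height `T`: `Re Σ_{ρ ∈ lfunctionZeroBox χ T} m_ρ (1 − 1/ρ)^n` (ALL non-trivial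
zeros with `|Im ρ| ≤ T`, both signs, with multiplicity `DirichletDisc.zeroOrder χ ρ`, whatever their real part; the boxes
of `LiDirichlet.liCoeffChar`). -/
def charZeroTrace (χ : DirichletCharacter ℂ q) (n : ℕ) (T : ℝ) : ℝ :=
  (∑ᶠ ρ ∈ lfunctionZeroBox χ T, (DirichletDisc.zeroOrder χ ρ : ℂ) * (1 - 1 / ρ) ^ n).re

/-- The WINDOWED zero trace of `L(s, χ)`: `Re Σ_{T₁ < |Im ρ| ≤ T₂} m_ρ (1 − 1/ρ)^n`. -/
def charZeroTraceWindow (χ : DirichletCharacter ℂ q) (n : ℕ) (T₁ T₂ : ℝ) : ℝ :=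
  charZeroTrace χ n T₂ - charZeroTrace χ n T₁

/-- The UPPER zero trace: the same sum over the zeros with `0 < Im ρ ≤ T` only (the residues of Bombieri's rectangle;
`charZeroTraceWindow χ = charUpperTraceWindow χ + charUpperTraceWindow χ⁻¹` by conjugation — a support statement of the
route, not assumed here). -/
def charUpperZeroTrace (χ : DirichletCharacter ℂ q) (n : ℕ) (T : ℝ) : ℝ :=
  (∑ᶠ ρ ∈ lfunctionZeroBox χ T ∩ {ρ : ℂ | 0 < ρ.im}, (DirichletDisc.zeroOrder χ ρ : ℂ) * (1 - 1 / ρ) ^ n).re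

/-- The windowed UPPER zero trace `Re Σ_{T₁ < Im ρ ≤ T₂} m_ρ (1 − 1/ρ)^n`. -/
def charUpperTraceWindow (χ : DirichletCharacter ℂ q) (n : ℕ) (T₁ T₂ : ℝ) : ℝ :=
  charUpperZeroTrace χ n T₂ - charUpperZeroTrace χ n T₁

/-- The character's Riemann–von Mangoldt density `g_χ(t) = ½ Re ψ((½ + a + it)/2) + ½ log(q/π)`, `a = charParity χ`
(`= Im d/dt log[(q/π)^{(s+a)/2} Γ((s+a)/2)]` at `s = ½ + it`; per sign of `Im ρ` the zero density is `g_χ/π`; for `q = 1`,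
`a = 0` it is PART D's `liGammaDensity = ϑ'`). -/
def charGammaDensity (χ : DirichletCharacter ℂ q) (t : ℝ) : ℝ :=
  (logDeriv Complex.Gamma ((1 / 2 + (charParity χ : ℂ) + (t : ℂ) * Complex.I) / 2)).re / 2
    + Real.log (q / Real.pi) / 2

/-- The SMOOTH counterpart of the windowed trace of `L(s, χ)`: `(2/π) ∫_{T₁}^{T₂} cos(nθ(t)) g_χ(t) dt`. -/
def charSmoothTraceWindow (χ : DirichletCharacter ℂ q) (n : ℕ) (T₁ T₂ : ℝ) : ℝ :=
  2 / Real.pi * ∫ t in T₁..T₂, Real.cos (n * liZeroAngle t) * charGammaDensity χ t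

/-- The TWISTED ECHO of the prime power `m` with complex weight `z` (the value `χ(m)`):
`Re[z · A_m n^{1/4} e^{−i(2√(n log m) + π/4)}] = A_m n^{1/4} (Re z · cos(2√(n log m) + π/4) + Im z · sin(2√(n log m) + π/4))`,
`A_m = π^{−1/2} Λ(m) m^{−1/2} (log m)^{−3/4}` — what ONE character's upper zeros hear (`liPrimeEchoTwist 1 m n = liPrimeEcho m n`). -/
def liPrimeEchoTwist (z : ℂ) (m n : ℕ) : ℝ :=
  (Λ m : ℝ) / Real.sqrt m / Real.sqrt Real.pi * Real.log m ^ (-(3 / 4 : ℝ)) *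
    ((n : ℝ) ^ (1 / 4 : ℝ) *
      (z.re * Real.cos (2 * Real.sqrt (n * Real.log m) + Real.pi / 4)
        + z.im * Real.sin (2 * Real.sqrt (n * Real.log m) + Real.pi / 4)))

/-- Glue (PROVED): the untwisted echo is PART D's `liPrimeEcho`. -/
theorem liPrimeEchoTwist_one (m n : ℕ) : liPrimeEchoTwist 1 m n = liPrimeEcho m n := by
  simp [liPrimeEchoTwist, liPrimeEcho]

/-- Glue (PROVED): a character and its conjugate together hear `2 Re χ(m) · E_m(n)` — the both-signs statistic is
convention-free. -/
theorem liPrimeEchoTwist_add_conj (z : ℂ) (m n : ℕ) :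
    liPrimeEchoTwist z m n + liPrimeEchoTwist (conj z) m n = 2 * z.re * liPrimeEcho m n := by
  simp only [liPrimeEchoTwist, liPrimeEcho, Complex.conj_re, Complex.conj_im]
  ring

/-- Glue (PROVED): the twist by `0` (a prime dividing the modulus) is silent. -/
theorem liPrimeEchoTwist_zero (m n : ℕ) : liPrimeEchoTwist 0 m n = 0 := by
  simp [liPrimeEchoTwist]

/-! ## PART E — contour vocabulary for `L(s, χ)` (Bombieri's rectangle; PART D's weights `liWeight`, `liSymWeight`,
`liRightPt` reused verbatim) -/

/-- `(1/π) Re ∫_{T₁}^{T₂} ξ'/ξ(3/2 + iy, χ) k_n(3/2 + iy) dy`, `ξ(·, χ) = dirichletXi χ` — the two vertical edges, the left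
one folded onto the right by `ξ'/ξ(1 − w̄, χ) = −conj ξ'/ξ(w, χ)`. -/
def charRightEdge (χ : DirichletCharacter ℂ q) (n : ℕ) (T₁ T₂ : ℝ) : ℝ :=
  1 / Real.pi * (∫ y in T₁..T₂, logDeriv (dirichletXi χ) (liRightPt y) * liSymWeight n (liRightPt y)).re

/-- `(1/π) Im ∫_{−1/2}^{3/2} ξ'/ξ(x + iT, χ) F_n(x + iT) dx` — one horizontal edge of the rectangle. -/
def charHorizTerm (χ : DirichletCharacter ℂ q) (n : ℕ) (T : ℝ) : ℝ :=
  1 / Real.pi *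
    (∫ x in (-(1 / 2 : ℝ))..(3 / 2 : ℝ),
      logDeriv (dirichletXi χ) (x + T * Complex.I) * liWeight n (x + T * Complex.I)).im

/-- GAMMA piece of the right edge: the weight against `½ log(q/π) + ½ ψ((w + a)/2)` (no polar piece: `ξ(·, χ)` is entire
and `L(s, χ)` has no pole for `q > 1`). -/
def charGammaEdge (χ : DirichletCharacter ℂ q) (n : ℕ) (T₁ T₂ : ℝ) : ℝ :=
  1 / Real.pi *
    (∫ y in T₁..T₂, ((Real.log (q / Real.pi) : ℂ) / 2
        + 1 / 2 * Complex.digamma ((liRightPt y + (charParity χ : ℂ)) / 2)) * liSymWeight n (liRightPt y)).re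

/-- PRIME piece of the right edge: the weight against `L(Λχ, w) = Σ_m Λ(m) χ(m) m^{−w} = −L'/L(w, χ)` (enters `ξ'/ξ` with
a MINUS). -/
def charPrimeEdge (χ : DirichletCharacter ℂ q) (n : ℕ) (T₁ T₂ : ℝ) : ℝ :=
  1 / Real.pi *
    (∫ y in T₁..T₂, LSeries (fun m : ℕ ↦ χ (m : ZMod q) * (Λ m : ℂ)) (liRightPt y) * liSymWeight n (liRightPt y)).re

/-- The set of GOOD heights for `χ`: `T` such that `ξ(·, χ)` has no zero on the closed segment `[−1/2, 3/2] × {T}` (every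
`[T, T + 1]` contains good heights at distance `≫ 1/log(qT)` from all ordinates — `ExplicitPsiChar.exists_goodHeight`). -/
def charGoodHeights (χ : DirichletCharacter ℂ q) : Set ℝ :=
  {T : ℝ | ∀ x ∈ Set.Icc (-(1 / 2 : ℝ)) (3 / 2), dirichletXi χ (x + T * Complex.I) ≠ 0}

/-! ## The rung leaf -/

/-- **RUNG LEAF «Li PRIME-ECHO LAW FOR DIRICHLET CHARACTERS» (window form; RH-FREE and GRH-FREE for all `n`;
PROOF-OF-DATA; NOT height-buying).**  For every primitive character `χ` mod `q > 1` and every fixed `c ≥ 5/4` (`>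
(log 2)^{−1/2} = 1.2011`, so the window `(√n, c√n]` contains the stationary height `t₀(2)` and no other `t₀(m)`):
`|Σ_{√n<|Im ρ|≤c√n} Re m_ρ (1 − 1/ρ)^n − (2/π)∫_{√n}^{c√n} cos(nθ) g_χ + Re χ(2) · A₂ n^{1/4} cos(2√(n log 2) + π/4)| ≤
C_{χ,c} log² n` for all `n ≥ 2`.  PRE-REGISTERED DATA CLASSES (ET3): flipped (`χ(2) = −1`: mod 3, mod 5 real), silent
(`q` even; and `Re χ(2) = 0`, e.g. the order-4 characters mod 5), same as `ζ` (`χ(2) = 1`: mod 7 real); amplitude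
`|Re χ(2)| · 0.36400`, phase `π/4`.  KILL: a character off its class, or a certified `n`-range on which `|window − smooth +
Re χ(2) E₂| / n^{1/4}` does not tend to `0`.  WHAT THIS IS NOT: not evidence for RH or GRH, not RH-sensitive, not a
positivity statement. [folklore mechanism; statement new] -/
@[conjecture] def LiZeroWindowEchoDirichlet : Prop :=
  ∀ (q : ℕ) [NeZero q] (χ : DirichletCharacter ℂ q), χ.IsPrimitive → 1 < q →
    ∀ c : ℝ, 5 / 4 ≤ c → ∃ C : ℝ, ∀ n : ℕ, 2 ≤ n →
      |charZeroTraceWindow χ n (Real.sqrt n) (c * Real.sqrt n)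
          - charSmoothTraceWindow χ n (Real.sqrt n) (c * Real.sqrt n)
          + (χ (2 : ZMod q)).re * liPrimeEcho 2 n|
        ≤ C * Real.log n ^ 2

/-! ## Companions of the leaf (typed targets of the family — NOT route items) and PROVED glue -/

/-- SILENT WINDOW FOR `Re χ(2) = 0` (RH-FREE; covers every EVEN modulus, where `χ(2) = 0`, and the quadrature-silent
complex characters with `χ(2) = ±i`): the windowed trace IS its smooth counterpart up to `O(log² n)` — no `n^{1/4}` term. -/
@[conjecture] def LiZeroWindowSilentDirichlet : Prop :=
  ∀ (q : ℕ) [NeZero q] (χ : DirichletCharacter ℂ q), χ.IsPrimitive → 1 < q → (χ (2 : ZMod q)).re = 0 →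
    ∀ c : ℝ, 5 / 4 ≤ c → ∃ C : ℝ, ∀ n : ℕ, 2 ≤ n →
      |charZeroTraceWindow χ n (Real.sqrt n) (c * Real.sqrt n)
          - charSmoothTraceWindow χ n (Real.sqrt n) (c * Real.sqrt n)|
        ≤ C * Real.log n ^ 2

/-- Glue (PROVED): the leaf gives the silent window whenever `Re χ(2) = 0`. -/
theorem liZeroWindowSilentDirichlet_of (h : LiZeroWindowEchoDirichlet) : LiZeroWindowSilentDirichlet := by
  intro q _ χ hprim hq h2 c hc
  obtain ⟨C, hC⟩ := h q χ hprim hq c hc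
  exact ⟨C, fun n hn ↦ by simpa [h2] using hC n hn⟩

omit [NeZero q] in
/-- For an EVEN modulus `2` is not a unit mod `q`, so `χ(2) = 0`. -/
theorem char_two_eq_zero_of_even (χ : DirichletCharacter ℂ q) (hq : 2 ∣ q) : χ (2 : ZMod q) = 0 := by
  have h : ¬ IsUnit ((2 : ℕ) : ZMod q) := by
    rw [ZMod.isUnit_prime_iff_not_dvd Nat.prime_two]
    exact fun h ↦ h hq
  exact_mod_cast χ.map_nonunit h

/-- Glue (PROVED): for every primitive character to an EVEN modulus the leaf window is silent (ET3: mod 4, both mod 8). -/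
theorem liZeroWindowSilent_of_even_modulus (h : LiZeroWindowEchoDirichlet) {q : ℕ} [NeZero q]
    (χ : DirichletCharacter ℂ q) (hprim : χ.IsPrimitive) (hq : 1 < q) (heven : 2 ∣ q) {c : ℝ} (hc : 5 / 4 ≤ c) :
    ∃ C : ℝ, ∀ n : ℕ, 2 ≤ n →
      |charZeroTraceWindow χ n (Real.sqrt n) (c * Real.sqrt n)
          - charSmoothTraceWindow χ n (Real.sqrt n) (c * Real.sqrt n)| ≤ C * Real.log n ^ 2 :=
  liZeroWindowSilentDirichlet_of h q χ hprim hq (by simp [char_two_eq_zero_of_even χ heven]) c hc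

/-- GENERAL ECHO LAW FOR CHARACTERS (RH-FREE; the family's structure statement): «the zeros of `L(s, χ)` of height
`(c₁√n, c₂√n]` echo exactly the prime powers `m` with `c₂^{−2} ≤ log m < c₁^{−2}`, each with amplitude `Re χ(m) · A_m`».
ET3-type predictions for the window `(0.752√n, 1.08√n]` (primes 3, 4, 5): amplitudes `(Re χ(3)·0.3335, Re χ(4)·0.1530,
Re χ(5)·0.2842)`. -/
@[conjecture] def LiZeroWindowEchoesDirichlet : Prop :=
  ∀ (q : ℕ) [NeZero q] (χ : DirichletCharacter ℂ q), χ.IsPrimitive → 1 < q →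
    ∀ c₁ c₂ : ℝ, 0 < c₁ → c₁ < c₂ →
      (∀ m : ℕ, 2 ≤ m → (Λ m : ℝ) ≠ 0 → Real.log m ≠ 1 / c₁ ^ 2 ∧ Real.log m ≠ 1 / c₂ ^ 2) →
      ∃ C : ℝ, ∀ n : ℕ, 2 ≤ n →
        |charZeroTraceWindow χ n (c₁ * Real.sqrt n) (c₂ * Real.sqrt n)
            - charSmoothTraceWindow χ n (c₁ * Real.sqrt n) (c₂ * Real.sqrt n)
            + ∑ m ∈ Finset.Icc 2 ⌊Real.exp (1 / c₁ ^ 2)⌋₊,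
                (if 1 / c₂ ^ 2 ≤ Real.log m then (χ (m : ZMod q)).re * liPrimeEcho m n else 0)|
          ≤ C * Real.log n ^ 2

/-- Glue (PROVED): the leaf is the `m = 2` instance (`c₁ = 1`, `c₂ = c ≥ 5/4`) of the general character echo law. -/
theorem liZeroWindowEchoDirichlet_of_echoes (h : LiZeroWindowEchoesDirichlet) : LiZeroWindowEchoDirichlet := by
  intro q _ χ hprim hq c hc
  have hcsq : (25 : ℝ) / 16 ≤ c ^ 2 := by nlinarith
  have hc2 : 1 / c ^ 2 ≤ 16 / 25 := by
    have := one_div_le_one_div_of_le (by norm_num : (0 : ℝ) < 25 / 16) hcsq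
    simpa using this
  have hlog2 : (0.69 : ℝ) < Real.log 2 := by
    have := Real.log_two_gt_d9; norm_num at this ⊢; linarith
  have hle : 1 / c ^ 2 ≤ Real.log 2 := by linarith
  obtain ⟨C, hC⟩ := h q χ hprim hq 1 c one_pos (by linarith) (liEchoes_edge_hyp (by linarith) (by
    intro heq; linarith))
  refine ⟨C, fun n hn ↦ ?_⟩
  have key := hC n hn
  have hsum : (∑ m ∈ Finset.Icc 2 ⌊Real.exp (1 / (1 : ℝ) ^ 2)⌋₊,
      (if 1 / c ^ 2 ≤ Real.log m then (χ (m : ZMod q)).re * liPrimeEcho m n else 0))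
        = (χ (2 : ZMod q)).re * liPrimeEcho 2 n := by
    rw [floor_exp_one_div_one_sq, Finset.Icc_self, Finset.sum_singleton, if_pos (by exact_mod_cast hle)]
    simp only [Nat.cast_ofNat]
  rwa [hsum, one_mul] at key

/-! ## The COMPLEX form of the leaf (pre-registered 2026-08-26T02:34Z; CONFIRMED incl. the sign of the imaginary channel
by kit j248812: 13 primitive characters mod 5, 7, 9, 13 + ζ, PARI zeros |γ| ≤ 640, 200 n ∈ [10⁴, 10⁵], c = 2: fitted
cos-coefficients of Re and Im parts = (−Re χ(2), +Im χ(2)) to ±0.06 in units of A₂ n^{1/4}; order-4 characters (χ(2) = ±i)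
QUADRATURE-SILENT in the real part and full amplitude in the imaginary part) -/

/-- The COMPLEX zero trace `Σ_{ρ ∈ lfunctionZeroBox χ T} m_ρ (1 − 1/ρ)^n ∈ ℂ` (its real part is `charZeroTrace`). -/
def charZeroTraceC (χ : DirichletCharacter ℂ q) (n : ℕ) (T : ℝ) : ℂ :=
  ∑ᶠ ρ ∈ lfunctionZeroBox χ T, (DirichletDisc.zeroOrder χ ρ : ℂ) * (1 - 1 / ρ) ^ n

/-- The COMPLEX windowed zero trace `Σ_{T₁ < |Im ρ| ≤ T₂} m_ρ (1 − 1/ρ)^n` (both signs of `Im ρ`). -/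
def charZeroTraceWindowC (χ : DirichletCharacter ℂ q) (n : ℕ) (T₁ T₂ : ℝ) : ℂ :=
  charZeroTraceC χ n T₂ - charZeroTraceC χ n T₁

/-- The real part of the complex windowed zero trace is the real windowed zero trace:
`Re charZeroTraceWindowC χ n T₁ T₂ = charZeroTraceWindow χ n T₁ T₂` (termwise `Re`; used by
`liZeroWindowEchoDirichlet_of_complex`). -/
theorem charZeroTraceWindowC_re (χ : DirichletCharacter ℂ q) (n : ℕ) (T₁ T₂ : ℝ) :
    (charZeroTraceWindowC χ n T₁ T₂).re = charZeroTraceWindow χ n T₁ T₂ := by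
  simp [charZeroTraceWindowC, charZeroTraceC, charZeroTraceWindow, charZeroTrace, Complex.sub_re]

/-- **COMPLEX FORM OF THE LEAF** («the zeros of `L(s, χ)` in the √n-window hear the prime 2 with amplitude `χ̄(2)`»;
RH-FREE and GRH-FREE; PROOF-OF-DATA; NOT height-buying): for primitive `χ` mod `q > 1`, `c ≥ 5/4`, all `n ≥ 2`,
`‖Σ_{√n<|Im ρ|≤c√n} m_ρ (1 − 1/ρ)^n − S_χ(n; √n, c√n) + conj(χ(2)) · E₂(n)‖ ≤ C log² n` with the REAL chirp
`E₂(n) = liPrimeEcho 2 n = A₂ n^{1/4} cos(2√(n log 2) + π/4)`: real part = the leaf (`−Re χ(2) E₂`), imaginary part =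
`+Im χ(2) E₂` with NO smooth term (the Riemann–von Mangoldt densities of `χ` and `χ̄` coincide).  Mechanism: the resonant
part of the UPPER window sum of `L(s, χ)` is `−½ conj(χ(2)) A₂ n^{1/4} e^{+iΦ}` and the lower zeros of `L(s, χ)` are the
conjugates of the upper zeros of `L(s, χ̄)` (HOME/theory/route/p5/README-P5 §2).  Analogue in print: the both-signs
Landau–Gonek formula `Σ_{|γ_χ|≤T} x^{ρ_χ} = −(T/π) χ(x)Λ(x) + …` (Bhowmik–Halupczok–Matsumoto–Suzuki 2019, Prop. 2);
here the chirped weight reverses the frequency, whence `χ̄(2)`.  [statement new] -/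
@[conjecture] def LiZeroWindowEchoDirichletComplex : Prop :=
  ∀ (q : ℕ) [NeZero q] (χ : DirichletCharacter ℂ q), χ.IsPrimitive → 1 < q →
    ∀ c : ℝ, 5 / 4 ≤ c → ∃ C : ℝ, ∀ n : ℕ, 2 ≤ n →
      ‖charZeroTraceWindowC χ n (Real.sqrt n) (c * Real.sqrt n)
          - (charSmoothTraceWindow χ n (Real.sqrt n) (c * Real.sqrt n) : ℂ)
          + conj (χ (2 : ZMod q)) * (liPrimeEcho 2 n : ℂ)‖
        ≤ C * Real.log n ^ 2

/-- Glue (PROVED): the complex form implies the leaf (take real parts: `Re(conj χ(2) · E₂) = Re χ(2) · E₂`). -/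
theorem liZeroWindowEchoDirichlet_of_complex (h : LiZeroWindowEchoDirichletComplex) : LiZeroWindowEchoDirichlet := by
  intro q _ χ hprim hq c hc
  obtain ⟨C, hC⟩ := h q χ hprim hq c hc
  refine ⟨C, fun n hn ↦ ?_⟩
  have key := (Complex.abs_re_le_norm _).trans (hC n hn)
  simpa [Complex.sub_re, Complex.add_re, charZeroTraceWindowC_re, Complex.mul_re, Complex.conj_re, Complex.conj_im,
    Complex.ofReal_re, Complex.ofReal_im] using key

end Summit.RiemannHypothesis.RiemannHypothesis.Theorems.LiTheory

end
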